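import Literature.Geometry.Manifold.InjOnNhdsOfCompact
import Mathlib.Analysis.Complex.Basic
import Mathlib.Geometry.Manifold.ContMDiff.NormedSpace
import Mathlib.Geometry.Manifold.Instances.Real
import Mathlib.Geometry.Manifold.MFDeriv.FDeriv
import Mathlib.LinearAlgebra.Complex.FiniteDimensional
import Mathlib.Topology.MetricSpace.Bounded

/-!
# The crossing parameters of a two-chart sphere with a compact regular fibre are finite
(registered helper `helper_crossingsFinite` of the stub `stub_normalWitnessTransfer`, line
`cross-cap-laurent`, crux `GromovRecognitionRelEnd`, item stmt-SmoothPoincare4-11009)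

Setting: `X` a Hausdorff smooth `4`-manifold, `U ⊆ X` open, `g : X → ℂ` smooth on `U`,
`u v : ℂ → X` the two smooth charts of a sphere (`v w = u w⁻¹` for `w ≠ 0`, so `v 0` is the point
at infinity of the `u`-chart), `s : ℂ` with compact fibre `K = {y ∈ U | g y = s}`, such that the
real-smooth composite `z ↦ g (u z)` has onto derivative `ℂ →L[ℝ] ℂ` at every crossing parameter
(every `z` with `u z ∈ K`) and `v 0 ∉ K`.  Claim (`helper_crossingsFinite`): the set
`Z = {z | u z ∈ U ∧ g (u z) = s} = u ⁻¹' K` of crossing parameters is finite, and at each of its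
points `z` the punctured neighbourhood filter `𝓝[≠] z` eventually contains no crossing parameter.

Proof (preimage of a regular value under a map of manifolds of equal dimension: J. Milnor,
*Topology from the Differentiable Viewpoint* (1965), §1 p. 8; local injectivity of a map with
injective differential: M. W. Hirsch, *Differential Topology*, GTM 33 (1976), Ch. 2 §1,
Lemma 1.3).
* Isolation.  At a crossing parameter `z` the composite `φ = g ∘ u` is `C^∞` (`u z` lies in the
  open set `U` on which `g` is smooth); its derivative is onto, hence one-to-one (`ℂ` is a
  finite-dimensional real vector space, `LinearMap.injective_iff_surjective`; between vector
  spaces `mfderiv = fderiv`), so `φ` is injective on a neighbourhood of `z`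
  (`Literature.Geometry.Manifold.exists_mem_nhds_injOn_of_injective_fderiv`) and no `z' ≠ z`
  near `z` has `φ z' = s = φ z`.
* Finiteness.  `K` is compact in the Hausdorff space `X`, hence closed, so `Z = u ⁻¹' K` is
  closed; `Z` is bounded, because `v 0 ∉ K` and continuity of `v` give a radius `ρ > 0` with
  `v w ∉ K` for `‖w‖ < ρ`, whence `u z = v z⁻¹ ∉ K` for `‖z‖ > ρ⁻¹`.  So `Z` is compact (`ℂ` is a
  proper metric space), and a compact set each of whose points has a punctured neighbourhood
  missing the set is finite (a finite subcover by these neighbourhoods, each meeting `Z` in at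
  most its centre).
No new definitions.
-/

noncomputable section

open scoped Manifold ContDiff Topology
open Set Function Filter Metric

-- the prescribed namespace `Summit.<P>.<Sub>.…` duplicates `SmoothPoincare4` (P = Sub)
set_option linter.dupNamespace false

namespace Summit.SmoothPoincare4.SmoothPoincare4.Theorems.GromovRecognitionRelEnd.CrossCapLaurent

namespace HelperCrossingsFinite

/-- **A compact set all of whose points are isolated is finite**, with isolation in the strong
form "the punctured neighbourhood filter `𝓝[≠] z` eventually avoids the set": cover the set by
the finitely many isolating neighbourhoods of a subcover; each meets the set in at most its
centre. [folklore] -/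
theorem finite_of_isCompact_of_eventually_not_mem {α : Type*} [TopologicalSpace α] {Z : Set α}
    (hZ : IsCompact Z) (hiso : ∀ z ∈ Z, ∀ᶠ z' in 𝓝[≠] z, z' ∉ Z) : Z.Finite := by
  obtain ⟨t, -, hcover⟩ := hZ.elim_nhds_subcover (fun z => {z' | z' ∈ ({z}ᶜ : Set α) → z' ∉ Z})
    fun z hz => eventually_nhdsWithin_iff.1 (hiso z hz)
  refine t.finite_toSet.subset fun z hz => ?_
  obtain ⟨x, hx, hzx⟩ := mem_iUnion₂.1 (hcover hz)
  by_contra hzt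
  exact hzx (fun h => hzt (Finset.mem_coe.2 (mem_singleton_iff.1 h ▸ hx))) hz

/-- **The crossing set is bounded**: if `v w = u w⁻¹` off the origin, `v` is continuous, `K` is
closed and `v 0 ∉ K`, then `u ⁻¹' K` is a bounded subset of `ℂ` (no crossings near the point
at infinity of the `u`-chart). [folklore] -/
theorem isBounded_preimage_of_inversion {X : Type*} [TopologicalSpace X] {u v : ℂ → X}
    {K : Set X} (hv : Continuous v) (huv : ∀ z : ℂ, z ≠ 0 → v z = u z⁻¹) (hK : IsClosed K)
    (hv0 : v 0 ∉ K) : Bornology.IsBounded (u ⁻¹' K) := by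
  obtain ⟨ρ, hρ, hball⟩ := Metric.mem_nhds_iff.1
    (hv.continuousAt.preimage_mem_nhds (hK.isOpen_compl.mem_nhds hv0))
  refine (isBounded_closedBall (x := (0 : ℂ)) (r := ρ⁻¹)).subset fun z hz => ?_
  rw [mem_closedBall, dist_zero_right]
  by_contra! hlt
  have hz0 : z ≠ 0 := by
    rintro rfl
    rw [norm_zero] at hlt
    exact (not_lt.2 (inv_nonneg.2 hρ.le)) hlt
  have hzinv : z⁻¹ ∈ ball (0 : ℂ) ρ := by
    rw [mem_ball, dist_zero_right, norm_inv]
    exact inv_lt_of_inv_lt₀ hρ hlt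
  have h1 : v z⁻¹ ∉ K := hball hzinv
  exact h1 (by rw [huv _ (inv_ne_zero hz0), inv_inv]; exact hz)

end HelperCrossingsFinite

open HelperCrossingsFinite in
/-- **Finiteness and isolation of the crossing parameters.** For a Hausdorff smooth
`4`-manifold `X`, `U ⊆ X` open, `g : X → ℂ` smooth on `U`, smooth `u v : ℂ → X` with
`v w = u w⁻¹` for `w ≠ 0`, and `s : ℂ` with compact fibre `{y ∈ U | g y = s}` missing `v 0` and
such that `z ↦ g (u z)` has onto derivative at every crossing parameter, the set
`{z | u z ∈ U ∧ g (u z) = s}` is finite and each of its points `z` has a punctured neighbourhood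
(`𝓝[≠] z`) free of crossing parameters.  Isolation: onto derivative `ℂ →L[ℝ] ℂ` is injective, so
the composite is locally injective; finiteness: the crossing set is closed and bounded in `ℂ`,
hence compact, and compact with isolated points is finite.
[cite: HirschDT1976, Ch. 2 §1 Lemma 1.3] -/
theorem helper_crossingsFinite : ∀ (X : Type) [TopologicalSpace X] [T2Space X] [ChartedSpace (EuclideanSpace ℝ (Fin 4)) X] [IsManifold (𝓡 4) ∞ X] (U : Set X) (g : X → ℂ) (u v : ℂ → X) (s : ℂ), IsOpen U → ContMDiffOn (𝓡 4) 𝓘(ℝ, ℂ) ∞ g U → ContMDiff 𝓘(ℝ, ℂ) (𝓡 4) ∞ u → ContMDiff 𝓘(ℝ, ℂ) (𝓡 4) ∞ v → (∀ z : ℂ, z ≠ 0 → v z = u z⁻¹) → IsCompact {y | y ∈ U ∧ g y = s} → (∀ z : ℂ, u z ∈ U → g (u z) = s → Function.Surjective (mfderiv 𝓘(ℝ, ℂ) 𝓘(ℝ, ℂ) (fun z => g (u z)) z)) → ¬ (v 0 ∈ U ∧ g (v 0) = s) → {z : ℂ | u z ∈ U ∧ g (u z) = s}.Finite ∧ ∀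 z : ℂ, u z ∈ U → g (u z) = s → ∀ᶠ z' in nhdsWithin z {z}ᶜ, ¬ (u z' ∈ U ∧ g (u z') = s) := by
  intro X _ _ _ _ U g u v s hU hg hu hv huv hK hreg hv0
  -- isolation of each crossing parameter
  have hiso : ∀ z : ℂ, u z ∈ U → g (u z) = s →
      ∀ᶠ z' in 𝓝[≠] z, ¬ (u z' ∈ U ∧ g (u z') = s) := by
    intro z hzU hzs
    -- the composite `g ∘ u` is smooth at `z`
    have hφ : ContMDiffAt 𝓘(ℝ, ℂ) 𝓘(ℝ, ℂ) ∞ (g ∘ u) z :=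
      (hg.contMDiffAt (hU.mem_nhds hzU)).comp z (hu z)
    have hφ' : ContDiffAt ℝ ∞ (fun w => g (u w)) z := contMDiffAt_iff_contDiffAt.1 hφ
    -- its derivative is onto, hence one-to-one
    have hsurj : Surjective (fderiv ℝ (fun w => g (u w)) z) := by
      have h := hreg z hzU hzs
      rwa [mfderiv_eq_fderiv] at h
    have hinj : Injective (fderiv ℝ (fun w => g (u w)) z) :=
      (LinearMap.injective_iff_surjective
        (f := (fderiv ℝ (fun w => g (u w)) z : ℂ →ₗ[ℝ] ℂ))).2 hsurj
    -- so the composite is injective near `z`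
    obtain ⟨N, hN, hNinj⟩ :=
      Literature.Geometry.Manifold.exists_mem_nhds_injOn_of_injective_fderiv hφ' (by simp) hinj
    rw [eventually_nhdsWithin_iff]
    filter_upwards [hN] with z' hz'N hz'ne hz'
    exact hz'ne (hNinj hz'N (mem_of_mem_nhds hN) (hz'.2.trans hzs.symm))
  refine ⟨?_, hiso⟩
  -- the crossing set is the preimage of the closed fibre: closed, bounded, hence compact
  have hKc : IsClosed {y | y ∈ U ∧ g y = s} := hK.isClosed
  have hZK : {z : ℂ | u z ∈ U ∧ g (u z) = s} = u ⁻¹' {y | y ∈ U ∧ g y = s} := rfl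
  have hZc : IsClosed {z : ℂ | u z ∈ U ∧ g (u z) = s} :=
    hZK ▸ hKc.preimage hu.continuous
  have hZb : Bornology.IsBounded {z : ℂ | u z ∈ U ∧ g (u z) = s} :=
    hZK ▸ isBounded_preimage_of_inversion hv.continuous huv hKc hv0
  -- compact with isolated points: finite
  exact finite_of_isCompact_of_eventually_not_mem (isCompact_of_isClosed_isBounded hZc hZb)
    fun z hz => hiso z hz.1 hz.2
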